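import Summits.AnomalousDissipation.AnomalousDissipation.Theses.NeutralTaylorWaves
import Summits.AnomalousDissipation.AnomalousDissipation.Theorems.NeutralTaylorWavesNonresonantSelectionApproxKellerBordering
import Summits.AnomalousDissipation.AnomalousDissipation.Theorems.NeutralTaylorWavesNonresonantSelectionBorderedGapStability
import HarnessLib

/-!
# Reduction of the crux `NeutralTaylorWaves.NonresonantSelection` (stmt-AnomalousDissipation-16294)
# to KELLER DATA ON ONE COHERENT SPINE — the sorry-free part of line `birth`, landed as theorems

The crux is literally `TaylorWaveQuasiSteady → NonresonantTaylorWaves`; its antecedent is an opaque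
existential, so every proof must build a structured family and prove the bordered a-priori bound for it.
Line `birth` (`Cruxes/NonresonantSelection/Lines/birth.lean`) factored out everything that does NOT
depend on the family: the approximate Keller bordering lemma (`stub_approxKellerBordering`, p161672) and the
Kato-type stability of polynomial bordered bounds (`stub_borderedGapStability`, p159559). This file composes
the two BY NAME into the reduction the planners asked for (`promote-stub: stub_spineCore`), with no `sorry`
and no skeleton-local definition:

* `nonresonantSelection_spine_transfer` — ONE base, ONE viscosity: Keller data at a smooth divergence-free
  reference base `(w₁, c₁)` with largeness `Λ ≥ 1` (phase direction `∂₃w₁` of size `Λ⁻¹ ≤ ‖∂₃w₁‖₂ ≤ Λ`,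
  adjoint test field `ψ` with pairing `Λ|⟨ψ, ∂₃w₁⟩| ≥ 1`, approximate kernel `‖A₁(∂₃w₁, q₃)‖₂ ≤ Λ⁻³`,
  approximate cokernel `2|⟨ψ, A₁(v, r)⟩| ≤ Λ⁻³‖v‖₂`, reduced gap `‖u‖₂ ≤ Λ‖A₁(u, r)‖₂` on `u ⊥ ∂₃w₁`)
  PLUS a `δ`-close base `(w, c)` in `W^{1,∞} × drift` with `sup‖∂ᵢw‖ ≤ G` and
  `δ(1 + 10Λ³)(1 + G) ≤ ν/16`, `0 < ν ≤ 1` ⇒ the BORDERED bound at `(w, c)` with constant `2(1 + 10Λ³)`.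
* `nonresonantTaylorWaves_of_spineCore` — the sequence-level packaging: the body of `birth`'s only open
  stub `stub_spineCore` (one force, `ν_n → 0⁺`, a spine `(w₁ n, c₁ n)` carrying Keller data with
  `Λ_n = C₀ν_n^{-K₀}` for infinitely many `n`, and for every order `K` an all-`n` quasi-steady family with
  the target's sup bounds, `ν_n^a`-close to the spine, `3K₀ + 3 ≤ a`) implies the ROUTE TARGET
  `NonresonantTaylorWaves` with `(C₀, K₀) ↦ (2(1 + 10C₀³), 3K₀)`.
* `nonresonantSelection_of_spineCore` — hence the crux from `TaylorWaveQuasiSteady → (spine-core data)`.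

So a Skolemised re-lining (named family + "Keller data at the spine" + "coherent quasi-steady family")
closes the target by instantiating `nonresonantTaylorWaves_of_spineCore`; what remains open is exactly the
spine-core data (reduced injectivity modulus on `(∂₃w₁)^⊥` and the adjoint pairing `⟨∂₃w₁, ψ⟩ ≠ 0` with
polynomial control), cf. `Cruxes/NonresonantSelection/NOTES.md`, `BarrierNoteDSZBracket.md`.
-/

-- `Summit.<Summit>.<Problem>` is the tree's mandated summit-side namespace; for this single-conjunct
-- summit the two segments coincide, so the duplicate is deliberate.
set_option linter.dupNamespace false

noncomputable section

namespace Summit.AnomalousDissipation.AnomalousDissipation.Theorems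

open MeasureTheory Filter Topology
open scoped InnerProductSpace
open Literature.Analysis.FunctionSpaces
open Summit.AnomalousDissipation.AnomalousDissipation.Theses.NeutralTaylorWaves

/-- **Transfer of the bordered bound from a spine with Keller data to a nearby base** (one viscosity,
one pair of bases; `stub_approxKellerBordering` then `stub_borderedGapStability`). At a smooth
divergence-free reference base `(w₁, c₁)` let `Λ ≥ 1` control the phase direction
(`‖∂₃w₁‖₂ ≤ Λ`, `Λ‖∂₃w₁‖₂ ≥ 1`), the pairing with a smooth `ψ`, `‖ψ‖₂ ≤ 1` (`Λ|⟨ψ, ∂₃w₁⟩| ≥ 1`), the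
approximate kernel (`‖A₁(∂₃w₁, q₃)‖₂ ≤ Λ⁻³`), the approximate cokernel
(`2|⟨ψ, A₁(v, r)⟩| ≤ Λ⁻³‖v‖₂`) and the reduced gap (`‖u‖₂ ≤ Λ‖A₁(u, r)‖₂` for test fields `u ⊥ ∂₃w₁`)
of the unbordered linearised operator `A₁(v, r) = w₁·∇v + v·∇w₁ − νΔv + ∇r − c₁∂₃v`. If a smooth
divergence-free base `(w, c)` has `sup‖∂ᵢw‖ ≤ G`, is `δ`-close to `(w₁, c₁)`
(`sup‖w − w₁‖, sup‖∂ᵢw − ∂ᵢw₁‖, |c − c₁| ≤ δ`) and `δ(1 + 10Λ³)(1 + G) ≤ ν/16` with `0 < ν ≤ 1`, then the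
bordered a-priori bound holds at `(w, c)` with constant `2(1 + 10Λ³)`. -/
theorem nonresonantSelection_spine_transfer
    (ν c₁ c Λ G δ : ℝ) (w₁ w ψ : UnitAddTorus (Fin 3) → EuclideanSpace ℝ (Fin 3))
    (q₃ : UnitAddTorus (Fin 3) → ℝ)
    (hν : 0 < ν) (hν1 : ν ≤ 1) (hΛ : 1 ≤ Λ) (hG : 0 ≤ G) (hδ : 0 ≤ δ)
    (hw₁ : Torus.IsSmooth w₁) (hw₁div : Torus.IsDivFree w₁) (hw : Torus.IsSmooth w)
    (hwdiv : Torus.IsDivFree w) (hψ : Torus.IsSmooth ψ) (hq₃ : Torus.IsSmooth q₃)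
    (hψ1 : (∫ x, ‖ψ x‖ ^ 2) ≤ 1)
    (hΦle : Real.sqrt (∫ x, ‖Torus.partialDeriv (2 : Fin 3) w₁ x‖ ^ 2) ≤ Λ)
    (hΦge : 1 ≤ Λ * Real.sqrt (∫ x, ‖Torus.partialDeriv (2 : Fin 3) w₁ x‖ ^ 2))
    (hpair : 1 ≤ Λ * |∫ x, inner ℝ (ψ x) (Torus.partialDeriv (2 : Fin 3) w₁ x)|)
    (hker : Real.sqrt (∫ x, ‖Torus.convect w₁ (Torus.partialDeriv (2 : Fin 3) w₁) x +
        Torus.convect (Torus.partialDeriv (2 : Fin 3) w₁) w₁ x -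
        ν • Torus.laplacian (Torus.partialDeriv (2 : Fin 3) w₁) x + Torus.gradient q₃ x -
        c₁ • Torus.partialDeriv (2 : Fin 3) (Torus.partialDeriv (2 : Fin 3) w₁) x‖ ^ 2) ≤ Λ⁻¹ ^ 3)
    (hcoker : ∀ (v : UnitAddTorus (Fin 3) → EuclideanSpace ℝ (Fin 3)) (r : UnitAddTorus (Fin 3) → ℝ),
      Torus.IsSmooth v → Torus.IsSmooth r → Torus.IsDivFree v → Torus.HasZeroMean v →
      2 * |∫ x, inner ℝ (ψ x) (Torus.convect w₁ v x + Torus.convect v w₁ x -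
          ν • Torus.laplacian v x + Torus.gradient r x - c₁ • Torus.partialDeriv (2 : Fin 3) v x)| ≤
        Λ⁻¹ ^ 3 * Real.sqrt (∫ x, ‖v x‖ ^ 2))
    (hgap : ∀ (u : UnitAddTorus (Fin 3) → EuclideanSpace ℝ (Fin 3)) (r : UnitAddTorus (Fin 3) → ℝ),
      Torus.IsSmooth u → Torus.IsSmooth r → Torus.IsDivFree u → Torus.HasZeroMean u →
      (∫ x, inner ℝ (u x) (Torus.partialDeriv (2 : Fin 3) w₁ x)) = 0 →
      Real.sqrt (∫ x, ‖u x‖ ^ 2) ≤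
        Λ * Real.sqrt (∫ x, ‖Torus.convect w₁ u x + Torus.convect u w₁ x - ν • Torus.laplacian u x +
          Torus.gradient r x - c₁ • Torus.partialDeriv (2 : Fin 3) u x‖ ^ 2))
    (hsupG : ∀ (i : Fin 3) x, ‖Torus.partialDeriv i w x‖ ≤ G)
    (hprox0 : ∀ x, ‖w x - w₁ x‖ ≤ δ)
    (hprox1 : ∀ (i : Fin 3) x, ‖Torus.partialDeriv i w x - Torus.partialDeriv i w₁ x‖ ≤ δ)
    (hproxc : |c - c₁| ≤ δ)
    (hsmall : δ * (1 + 10 * Λ ^ 3) * (1 + G) ≤ ν / 16) :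
    ∀ (v : UnitAddTorus (Fin 3) → EuclideanSpace ℝ (Fin 3)) (r : UnitAddTorus (Fin 3) → ℝ) (b : ℝ),
      Torus.IsSmooth v → Torus.IsSmooth r → Torus.IsDivFree v → Torus.HasZeroMean v →
      (∫ x, ‖v x‖ ^ 2) + b ^ 2 ≤
        (2 * (1 + 10 * Λ ^ 3)) ^ 2 * ((∫ x, ‖Torus.convect w v x + Torus.convect v w x -
            ν • Torus.laplacian v x + Torus.gradient r x - c • Torus.partialDeriv (2 : Fin 3) v x -
            b • Torus.partialDeriv (2 : Fin 3) w x‖ ^ 2) +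
          (∫ x, inner ℝ (v x) (Torus.partialDeriv (2 : Fin 3) w x)) ^ 2) := by
  have hΛ0 : 0 < Λ := one_pos.trans_le hΛ
  have hΛ3 : Λ⁻¹ ^ 3 * Λ ^ 3 = 1 := by
    rw [inv_pow, inv_mul_cancel₀ (pow_ne_zero _ hΛ0.ne')]
  -- the bordered bound at the spine with constant `10 Λ³` (approximate Keller bordering lemma)
  have key₁ := stub_approxKellerBordering ν c₁ Λ (Λ⁻¹ ^ 3) (Λ⁻¹ ^ 3 / 2) w₁ ψ q₃ hΛ (by positivity)
    (by positivity) hΛ3.le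
    (by rw [show 2 * (Λ⁻¹ ^ 3 / 2) * Λ ^ 3 = Λ⁻¹ ^ 3 * Λ ^ 3 by ring, hΛ3])
    hw₁ hw₁div hψ hq₃ hψ1 hΦle hΦge hpair hker
    (fun v r hv hr hvdiv hvmean => by
      have h := hcoker v r hv hr hvdiv hvmean
      have h0 : 0 ≤ Real.sqrt (∫ x, ‖v x‖ ^ 2) := Real.sqrt_nonneg _
      nlinarith [h, h0])
    hgap
  -- transfer it to the nearby base (Kato-type stability)
  exact stub_borderedGapStability ν w₁ w c₁ c (10 * Λ ^ 3) G δ hν hν1 (by positivity) hG hδ hw₁ hw hwdiv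
    key₁ hsupG hprox0 hprox1 hproxc hsmall

/-- **The route target from Keller data on one coherent spine** (the body of line `birth`'s only open
stub `stub_spineCore`, taken as a hypothesis). Data: one smooth divergence-free mean-zero force `f`,
viscosities `ν_n → 0⁺`, `E`, `ε₀ > 0`, `C₀ ≥ 1`, `K₀`, `3K₀ + 3 ≤ a`, a smooth divergence-free spine
`(w₁ n, c₁ n)`; for infinitely many `n` (with `ν_n ≤ 1`) Keller data at the spine with
`Λ_n = C₀ν_n^{-K₀}` (phase size, pairing with an adjoint test field `ψ`, approximate kernel
`∂₃w₁`, approximate cokernel `ψ`, reduced gap on `(∂₃w₁)^⊥`); and for every order `K` a constant `C_K`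
with, for EVERY `n`, an order-`K` quasi-steady state `(w, q, c)` for the SAME `f` (light, loud, residual
`≤ C_Kν_n^K`, the target's sup bounds) that is `C_Kν_n^a`-close to the spine in `W^{1,∞} × drift`.
Conclusion: `NonresonantTaylorWaves` with `(C₀, K₀) ↦ (2(1 + 10C₀³), 3K₀)` — given `K` and `N`, pick
`n ≥ N` in the spine's Keller set so late that `16 C_K(1 + 10C₀³)(1 + C_K) ν_n ≤ 1`; then
`δ(1 + 10Λ_n³)(1 + G) ≤ ν_n/16` with `δ = C_Kν_n^a`, `G = C_Kν_n⁻¹` (`ν_n^a ≤ ν_n^{3K₀+3}`), and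
`nonresonantSelection_spine_transfer` gives the bordered bound at the order-`K` state with constant
`2(1 + 10C₀³ν_n^{-3K₀}) ≤ 2(1 + 10C₀³)ν_n^{-3K₀}`. -/
theorem nonresonantTaylorWaves_of_spineCore
    (hcoreData : ∃ f : UnitAddTorus (Fin 3) → EuclideanSpace ℝ (Fin 3),
      Torus.IsSmooth f ∧ Torus.IsDivFree f ∧ Torus.HasZeroMean f ∧
    ∃ (ν : ℕ → ℝ) (E ε₀ C₀ : ℝ) (K₀ a : ℕ)
      (w₁ : ℕ → UnitAddTorus (Fin 3) → EuclideanSpace ℝ (Fin 3)) (c₁ : ℕ → ℝ),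
      (∀ n, 0 < ν n) ∧ Tendsto ν atTop (𝓝 0) ∧ 0 < ε₀ ∧ 1 ≤ C₀ ∧ 3 * K₀ + 3 ≤ a ∧
      (∀ n, Torus.IsSmooth (w₁ n) ∧ Torus.IsDivFree (w₁ n)) ∧
      (∀ N : ℕ, ∃ n : ℕ, N ≤ n ∧ ν n ≤ 1 ∧
        ∃ (ψ : UnitAddTorus (Fin 3) → EuclideanSpace ℝ (Fin 3)) (q₃ : UnitAddTorus (Fin 3) → ℝ),
          Torus.IsSmooth ψ ∧ Torus.IsSmooth q₃ ∧ (∫ x, ‖ψ x‖ ^ 2) ≤ 1 ∧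
          Real.sqrt (∫ x, ‖Torus.partialDeriv (2 : Fin 3) (w₁ n) x‖ ^ 2) ≤ C₀ * (ν n)⁻¹ ^ K₀ ∧
          1 ≤ C₀ * (ν n)⁻¹ ^ K₀ * Real.sqrt (∫ x, ‖Torus.partialDeriv (2 : Fin 3) (w₁ n) x‖ ^ 2) ∧
          1 ≤ C₀ * (ν n)⁻¹ ^ K₀ * |∫ x, inner ℝ (ψ x) (Torus.partialDeriv (2 : Fin 3) (w₁ n) x)| ∧
          Real.sqrt (∫ x, ‖Torus.convect (w₁ n) (Torus.partialDeriv (2 : Fin 3) (w₁ n)) x +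
              Torus.convect (Torus.partialDeriv (2 : Fin 3) (w₁ n)) (w₁ n) x -
              (ν n) • Torus.laplacian (Torus.partialDeriv (2 : Fin 3) (w₁ n)) x + Torus.gradient q₃ x -
              (c₁ n) • Torus.partialDeriv (2 : Fin 3) (Torus.partialDeriv (2 : Fin 3) (w₁ n)) x‖ ^ 2) ≤
            (C₀ * (ν n)⁻¹ ^ K₀)⁻¹ ^ 3 ∧
          (∀ (v : UnitAddTorus (Fin 3) → EuclideanSpace ℝ (Fin 3)) (r : UnitAddTorus (Fin 3) → ℝ),
            Torus.IsSmooth v → Torus.IsSmooth r → Torus.IsDivFree v → Torus.HasZeroMean v →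
            2 * |∫ x, inner ℝ (ψ x) (Torus.convect (w₁ n) v x + Torus.convect v (w₁ n) x -
                (ν n) • Torus.laplacian v x + Torus.gradient r x -
                (c₁ n) • Torus.partialDeriv (2 : Fin 3) v x)| ≤
              (C₀ * (ν n)⁻¹ ^ K₀)⁻¹ ^ 3 * Real.sqrt (∫ x, ‖v x‖ ^ 2)) ∧
          (∀ (u : UnitAddTorus (Fin 3) → EuclideanSpace ℝ (Fin 3)) (r : UnitAddTorus (Fin 3) → ℝ),
            Torus.IsSmooth u → Torus.IsSmooth r → Torus.IsDivFree u → Torus.HasZeroMean u →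
            (∫ x, inner ℝ (u x) (Torus.partialDeriv (2 : Fin 3) (w₁ n) x)) = 0 →
            Real.sqrt (∫ x, ‖u x‖ ^ 2) ≤
              C₀ * (ν n)⁻¹ ^ K₀ * Real.sqrt (∫ x, ‖Torus.convect (w₁ n) u x + Torus.convect u (w₁ n) x -
                (ν n) • Torus.laplacian u x + Torus.gradient r x -
                (c₁ n) • Torus.partialDeriv (2 : Fin 3) u x‖ ^ 2))) ∧
      ∀ K : ℕ, ∃ C : ℝ, ∀ n : ℕ,
        ∃ (w : UnitAddTorus (Fin 3) → EuclideanSpace ℝ (Fin 3)) (q : UnitAddTorus (Fin 3) → ℝ) (c : ℝ),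
          Torus.IsSmooth w ∧ Torus.IsSmooth q ∧ Torus.IsDivFree w ∧ Torus.HasZeroMean w ∧ |c| ≤ C ∧
          (∫ x, ‖w x‖ ^ 2) ≤ E ∧
          |ν n * Torus.gradNormSq w - ε₀| ≤ C * Real.sqrt (ν n) ∧
          (∫ x, ‖Torus.convect w w x - (ν n) • Torus.laplacian w x + Torus.gradient q x -
              c • Torus.partialDeriv (2 : Fin 3) w x - f x‖ ^ 2) ≤ C * (ν n) ^ K ∧
          (∀ x, ‖w x‖ ≤ C) ∧ (∀ (i : Fin 3) x, ‖Torus.partialDeriv i w x‖ ≤ C * (ν n)⁻¹) ∧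
          (∀ (i j : Fin 3) x, ‖Torus.partialDeriv i (Torus.partialDeriv j w) x‖ ≤ C * (ν n)⁻¹ ^ 2) ∧
          (∀ x, ‖w x - w₁ n x‖ ≤ C * (ν n) ^ a) ∧
          (∀ (i : Fin 3) x, ‖Torus.partialDeriv i w x - Torus.partialDeriv i (w₁ n) x‖ ≤ C * (ν n) ^ a) ∧
          |c - c₁ n| ≤ C * (ν n) ^ a) :
    NonresonantTaylorWaves := by
  obtain ⟨f, hf, hfdiv, hfmean, ν, E, ε₀, C₀, K₀, a, w₁, c₁, hνpos, hνlim, hε₀, hC₀, ha, hw₁, hcore,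
    hfam⟩ := hcoreData
  refine ⟨f, hf, hfdiv, hfmean, ν, E, ε₀, 2 * (1 + 10 * C₀ ^ 3), 3 * K₀, hνpos, hνlim, hε₀, ?_⟩
  intro K
  obtain ⟨C, hC⟩ := hfam K
  refine ⟨C, ?_⟩
  intro N
  -- the constant of the spine bound and the smallness threshold `16 D ν n ≤ 1`
  set C₀' : ℝ := 10 * C₀ ^ 3 with hC₀'
  have hC₀'0 : 0 ≤ C₀' := by positivity
  set D : ℝ := C * (1 + C₀') * (1 + C) with hD
  have hνs : 0 < min 1 (1 / (16 * (|D| + 1))) := lt_min one_pos (by positivity)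
  obtain ⟨N₁, hN₁⟩ := eventually_atTop.1 (hνlim.eventually_lt_const hνs)
  obtain ⟨n, hn, hν1, ψ, q₃, hψ, hq₃, hψ1, hΦle, hΦge, hpair, hker, hcoker, hgap⟩ := hcore (max N N₁)
  obtain ⟨w, q, c, hw, hq, hwdiv, hwmean, hc, hE, hdiss, hres, hsup0, hsup1, hsup2, hprox0, hprox1,
    hproxc⟩ := hC n
  refine ⟨n, (le_max_left _ _).trans hn, w, q, c, hw, hq, hwdiv, hwmean, hc, hE, hdiss, hres, hsup0,
    hsup1, hsup2, ?_⟩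
  -- abbreviations and signs
  have hlt : ν n < min 1 (1 / (16 * (|D| + 1))) := hN₁ n ((le_max_right _ _).trans hn)
  set x : ℝ := ν n with hx_def
  have hx0 : 0 < x := hνpos n
  have hx : x ≠ 0 := hx0.ne'
  have hx1 : x ≤ 1 := hν1
  have hxκ : D * x ≤ 1 / 16 := by
    have h1 : x < 1 / (16 * (|D| + 1)) := hlt.trans_le (min_le_right _ _)
    have h2 : x * (16 * (|D| + 1)) < 1 := (lt_div_iff₀ (by positivity)).1 h1
    have h3 : D * x ≤ |D| * x := mul_le_mul_of_nonneg_right (le_abs_self D) hx0.le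
    nlinarith
  have hC0 : 0 ≤ C := (norm_nonneg _).trans (hsup0 0)
  have hy1 : 1 ≤ x⁻¹ ^ K₀ := one_le_pow₀ ((one_le_inv₀ hx0).2 hx1)
  have hy1' : 1 ≤ x⁻¹ ^ (3 * K₀) := one_le_pow₀ ((one_le_inv₀ hx0).2 hx1)
  -- the largeness parameter of the Keller data
  set Λ : ℝ := C₀ * x⁻¹ ^ K₀ with hΛ_def
  have hΛ1 : 1 ≤ Λ := by
    have := mul_le_mul hC₀ hy1 zero_le_one (zero_le_one.trans hC₀)
    simpa [hΛ_def] using this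
  have hΛe : 10 * Λ ^ 3 = C₀' * x⁻¹ ^ (3 * K₀) := by
    rw [hΛ_def, hC₀', mul_pow, ← pow_mul, mul_comm K₀ 3]; ring
  -- the smallness condition `δ (1 + M) (1 + G) ≤ x / 16` with `M = 10 Λ³ = C₀' x⁻¹^(3K₀)`
  have hsmall : C * x ^ a * (1 + 10 * Λ ^ 3) * (1 + C * x⁻¹) ≤ x / 16 := by
    rw [hΛe]
    have h1 : x ^ a ≤ x ^ (3 * K₀ + 3) := pow_le_pow_of_le_one hx0.le hx1 ha
    have e1 : x ^ (3 * K₀ + 3) * x⁻¹ ^ (3 * K₀) = x ^ 3 := by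
      rw [inv_pow, pow_add, mul_assoc, mul_comm (x ^ 3), ← mul_assoc,
        mul_inv_cancel₀ (pow_ne_zero _ hx), one_mul]
    have h2 : x ^ (3 * K₀ + 3) * (1 + C₀' * x⁻¹ ^ (3 * K₀)) ≤ (1 + C₀') * x ^ 3 := by
      have e : x ^ (3 * K₀ + 3) * (1 + C₀' * x⁻¹ ^ (3 * K₀)) = x ^ (3 * K₀ + 3) + C₀' * x ^ 3 := by
        rw [← e1]; ring
      have h : x ^ (3 * K₀ + 3) ≤ x ^ 3 := pow_le_pow_of_le_one hx0.le hx1 (by omega)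
      rw [e]
      nlinarith [hC₀'0, pow_pos hx0 3]
    have e2 : x ^ 3 * x⁻¹ = x ^ 2 := by field_simp
    have h3 : x ^ 3 * (1 + C * x⁻¹) ≤ (1 + C) * x ^ 2 := by
      have e : x ^ 3 * (1 + C * x⁻¹) = x ^ 3 + C * x ^ 2 := by rw [← e2]; ring
      have h : x ^ 3 ≤ x ^ 2 := pow_le_pow_of_le_one hx0.le hx1 (by norm_num)
      rw [e]
      nlinarith [pow_pos hx0 2]
    have hG0 : 0 ≤ 1 + C * x⁻¹ := by positivity
    have hM0 : 0 ≤ 1 + C₀' * x⁻¹ ^ (3 * K₀) := by positivity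
    calc C * x ^ a * (1 + C₀' * x⁻¹ ^ (3 * K₀)) * (1 + C * x⁻¹)
        ≤ C * x ^ (3 * K₀ + 3) * (1 + C₀' * x⁻¹ ^ (3 * K₀)) * (1 + C * x⁻¹) := by gcongr
      _ = C * (x ^ (3 * K₀ + 3) * (1 + C₀' * x⁻¹ ^ (3 * K₀))) * (1 + C * x⁻¹) := by ring
      _ ≤ C * ((1 + C₀') * x ^ 3) * (1 + C * x⁻¹) := by gcongr
      _ = C * (1 + C₀') * (x ^ 3 * (1 + C * x⁻¹)) := by ring
      _ ≤ C * (1 + C₀') * ((1 + C) * x ^ 2) := by gcongr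
      _ = (D * x) * x := by rw [hD]; ring
      _ ≤ (1 / 16) * x := mul_le_mul_of_nonneg_right hxκ hx0.le
      _ = x / 16 := by ring
  -- transfer the bound from the spine to the order-`K` state
  have key := nonresonantSelection_spine_transfer x (c₁ n) c Λ (C * x⁻¹) (C * x ^ a) (w₁ n) w ψ q₃
    hx0 hx1 hΛ1 (by positivity) (by positivity) (hw₁ n).1 (hw₁ n).2 hw hwdiv hψ hq₃ hψ1 hΦle hΦge hpair
    hker hcoker hgap hsup1 hprox0 hprox1 hproxc hsmall
  -- and enlarge the constant `2 (1 + C₀' x⁻¹^(3K₀)) ≤ 2 (1 + C₀') x⁻¹^(3K₀)`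
  have hle : 2 * (1 + 10 * Λ ^ 3) ≤ 2 * (1 + C₀') * x⁻¹ ^ (3 * K₀) := by
    rw [hΛe]
    nlinarith [hy1', hC₀'0]
  have hle2 : (2 * (1 + 10 * Λ ^ 3)) ^ 2 ≤ (2 * (1 + C₀') * x⁻¹ ^ (3 * K₀)) ^ 2 :=
    pow_le_pow_left₀ (by positivity) hle 2
  intro v r b hv hr hvdiv hvmean
  refine (key v r b hv hr hvdiv hvmean).trans ?_
  refine mul_le_mul_of_nonneg_right hle2 (add_nonneg ?_ (sq_nonneg _))
  exact integral_nonneg fun y => by positivity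

/-- **The crux from the spine core.** `NonresonantSelection` is `TaylorWaveQuasiSteady →
NonresonantTaylorWaves`; so it follows from any derivation of the spine-core data (the hypothesis of
`nonresonantTaylorWaves_of_spineCore`, i.e. the body of line `birth`'s `stub_spineCore`) from the
construction crux `TaylorWaveQuasiSteady`. -/
theorem nonresonantSelection_of_spineCore
    (hcore : TaylorWaveQuasiSteady → ∃ f : UnitAddTorus (Fin 3) → EuclideanSpace ℝ (Fin 3),
      Torus.IsSmooth f ∧ Torus.IsDivFree f ∧ Torus.HasZeroMean f ∧
    ∃ (ν : ℕ → ℝ) (E ε₀ C₀ : ℝ) (K₀ a : ℕ)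
      (w₁ : ℕ → UnitAddTorus (Fin 3) → EuclideanSpace ℝ (Fin 3)) (c₁ : ℕ → ℝ),
      (∀ n, 0 < ν n) ∧ Tendsto ν atTop (𝓝 0) ∧ 0 < ε₀ ∧ 1 ≤ C₀ ∧ 3 * K₀ + 3 ≤ a ∧
      (∀ n, Torus.IsSmooth (w₁ n) ∧ Torus.IsDivFree (w₁ n)) ∧
      (∀ N : ℕ, ∃ n : ℕ, N ≤ n ∧ ν n ≤ 1 ∧
        ∃ (ψ : UnitAddTorus (Fin 3) → EuclideanSpace ℝ (Fin 3)) (q₃ : UnitAddTorus (Fin 3) → ℝ),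
          Torus.IsSmooth ψ ∧ Torus.IsSmooth q₃ ∧ (∫ x, ‖ψ x‖ ^ 2) ≤ 1 ∧
          Real.sqrt (∫ x, ‖Torus.partialDeriv (2 : Fin 3) (w₁ n) x‖ ^ 2) ≤ C₀ * (ν n)⁻¹ ^ K₀ ∧
          1 ≤ C₀ * (ν n)⁻¹ ^ K₀ * Real.sqrt (∫ x, ‖Torus.partialDeriv (2 : Fin 3) (w₁ n) x‖ ^ 2) ∧
          1 ≤ C₀ * (ν n)⁻¹ ^ K₀ * |∫ x, inner ℝ (ψ x) (Torus.partialDeriv (2 : Fin 3) (w₁ n) x)| ∧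
          Real.sqrt (∫ x, ‖Torus.convect (w₁ n) (Torus.partialDeriv (2 : Fin 3) (w₁ n)) x +
              Torus.convect (Torus.partialDeriv (2 : Fin 3) (w₁ n)) (w₁ n) x -
              (ν n) • Torus.laplacian (Torus.partialDeriv (2 : Fin 3) (w₁ n)) x + Torus.gradient q₃ x -
              (c₁ n) • Torus.partialDeriv (2 : Fin 3) (Torus.partialDeriv (2 : Fin 3) (w₁ n)) x‖ ^ 2) ≤
            (C₀ * (ν n)⁻¹ ^ K₀)⁻¹ ^ 3 ∧
          (∀ (v : UnitAddTorus (Fin 3) → EuclideanSpace ℝ (Fin 3)) (r : UnitAddTorus (Fin 3) → ℝ),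
            Torus.IsSmooth v → Torus.IsSmooth r → Torus.IsDivFree v → Torus.HasZeroMean v →
            2 * |∫ x, inner ℝ (ψ x) (Torus.convect (w₁ n) v x + Torus.convect v (w₁ n) x -
                (ν n) • Torus.laplacian v x + Torus.gradient r x -
                (c₁ n) • Torus.partialDeriv (2 : Fin 3) v x)| ≤
              (C₀ * (ν n)⁻¹ ^ K₀)⁻¹ ^ 3 * Real.sqrt (∫ x, ‖v x‖ ^ 2)) ∧
          (∀ (u : UnitAddTorus (Fin 3) → EuclideanSpace ℝ (Fin 3)) (r : UnitAddTorus (Fin 3) → ℝ),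
            Torus.IsSmooth u → Torus.IsSmooth r → Torus.IsDivFree u → Torus.HasZeroMean u →
            (∫ x, inner ℝ (u x) (Torus.partialDeriv (2 : Fin 3) (w₁ n) x)) = 0 →
            Real.sqrt (∫ x, ‖u x‖ ^ 2) ≤
              C₀ * (ν n)⁻¹ ^ K₀ * Real.sqrt (∫ x, ‖Torus.convect (w₁ n) u x + Torus.convect u (w₁ n) x -
                (ν n) • Torus.laplacian u x + Torus.gradient r x -
                (c₁ n) • Torus.partialDeriv (2 : Fin 3) u x‖ ^ 2))) ∧
      ∀ K : ℕ, ∃ C : ℝ, ∀ n : ℕ,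
        ∃ (w : UnitAddTorus (Fin 3) → EuclideanSpace ℝ (Fin 3)) (q : UnitAddTorus (Fin 3) → ℝ) (c : ℝ),
          Torus.IsSmooth w ∧ Torus.IsSmooth q ∧ Torus.IsDivFree w ∧ Torus.HasZeroMean w ∧ |c| ≤ C ∧
          (∫ x, ‖w x‖ ^ 2) ≤ E ∧
          |ν n * Torus.gradNormSq w - ε₀| ≤ C * Real.sqrt (ν n) ∧
          (∫ x, ‖Torus.convect w w x - (ν n) • Torus.laplacian w x + Torus.gradient q x -
              c • Torus.partialDeriv (2 : Fin 3) w x - f x‖ ^ 2) ≤ C * (ν n) ^ K ∧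
          (∀ x, ‖w x‖ ≤ C) ∧ (∀ (i : Fin 3) x, ‖Torus.partialDeriv i w x‖ ≤ C * (ν n)⁻¹) ∧
          (∀ (i j : Fin 3) x, ‖Torus.partialDeriv i (Torus.partialDeriv j w) x‖ ≤ C * (ν n)⁻¹ ^ 2) ∧
          (∀ x, ‖w x - w₁ n x‖ ≤ C * (ν n) ^ a) ∧
          (∀ (i : Fin 3) x, ‖Torus.partialDeriv i w x - Torus.partialDeriv i (w₁ n) x‖ ≤ C * (ν n) ^ a) ∧
          |c - c₁ n| ≤ C * (ν n) ^ a) :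
    NonresonantSelection := fun hH => nonresonantTaylorWaves_of_spineCore (hcore hH)

/-- **Registered reduction stub** (`ledger workitem stub-add stmt-AnomalousDissipation-16294 --name
stub_spineReduction`): the spine-core data imply the route target — `nonresonantTaylorWaves_of_spineCore`
restated verbatim as the registered signature, so that this helper file rides with `--supports`. -/
theorem stub_spineReduction :
    (∃ f : UnitAddTorus (Fin 3) → EuclideanSpace ℝ (Fin 3),
      Torus.IsSmooth f ∧ Torus.IsDivFree f ∧ Torus.HasZeroMean f ∧
    ∃ (ν : ℕ → ℝ) (E ε₀ C₀ : ℝ) (K₀ a : ℕ)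
      (w₁ : ℕ → UnitAddTorus (Fin 3) → EuclideanSpace ℝ (Fin 3)) (c₁ : ℕ → ℝ),
      (∀ n, 0 < ν n) ∧ Tendsto ν atTop (𝓝 0) ∧ 0 < ε₀ ∧ 1 ≤ C₀ ∧ 3 * K₀ + 3 ≤ a ∧
      (∀ n, Torus.IsSmooth (w₁ n) ∧ Torus.IsDivFree (w₁ n)) ∧
      (∀ N : ℕ, ∃ n : ℕ, N ≤ n ∧ ν n ≤ 1 ∧
        ∃ (ψ : UnitAddTorus (Fin 3) → EuclideanSpace ℝ (Fin 3)) (q₃ : UnitAddTorus (Fin 3) → ℝ),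
          Torus.IsSmooth ψ ∧ Torus.IsSmooth q₃ ∧ (∫ x, ‖ψ x‖ ^ 2) ≤ 1 ∧
          Real.sqrt (∫ x, ‖Torus.partialDeriv (2 : Fin 3) (w₁ n) x‖ ^ 2) ≤ C₀ * (ν n)⁻¹ ^ K₀ ∧
          1 ≤ C₀ * (ν n)⁻¹ ^ K₀ * Real.sqrt (∫ x, ‖Torus.partialDeriv (2 : Fin 3) (w₁ n) x‖ ^ 2) ∧
          1 ≤ C₀ * (ν n)⁻¹ ^ K₀ * |∫ x, inner ℝ (ψ x) (Torus.partialDeriv (2 : Fin 3) (w₁ n) x)| ∧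
          Real.sqrt (∫ x, ‖Torus.convect (w₁ n) (Torus.partialDeriv (2 : Fin 3) (w₁ n)) x +
              Torus.convect (Torus.partialDeriv (2 : Fin 3) (w₁ n)) (w₁ n) x -
              (ν n) • Torus.laplacian (Torus.partialDeriv (2 : Fin 3) (w₁ n)) x + Torus.gradient q₃ x -
              (c₁ n) • Torus.partialDeriv (2 : Fin 3) (Torus.partialDeriv (2 : Fin 3) (w₁ n)) x‖ ^ 2) ≤
            (C₀ * (ν n)⁻¹ ^ K₀)⁻¹ ^ 3 ∧
          (∀ (v : UnitAddTorus (Fin 3) → EuclideanSpace ℝ (Fin 3)) (r : UnitAddTorus (Fin 3) → ℝ),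
            Torus.IsSmooth v → Torus.IsSmooth r → Torus.IsDivFree v → Torus.HasZeroMean v →
            2 * |∫ x, inner ℝ (ψ x) (Torus.convect (w₁ n) v x + Torus.convect v (w₁ n) x -
                (ν n) • Torus.laplacian v x + Torus.gradient r x -
                (c₁ n) • Torus.partialDeriv (2 : Fin 3) v x)| ≤
              (C₀ * (ν n)⁻¹ ^ K₀)⁻¹ ^ 3 * Real.sqrt (∫ x, ‖v x‖ ^ 2)) ∧
          (∀ (u : UnitAddTorus (Fin 3) → EuclideanSpace ℝ (Fin 3)) (r : UnitAddTorus (Fin 3) → ℝ),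
            Torus.IsSmooth u → Torus.IsSmooth r → Torus.IsDivFree u → Torus.HasZeroMean u →
            (∫ x, inner ℝ (u x) (Torus.partialDeriv (2 : Fin 3) (w₁ n) x)) = 0 →
            Real.sqrt (∫ x, ‖u x‖ ^ 2) ≤
              C₀ * (ν n)⁻¹ ^ K₀ * Real.sqrt (∫ x, ‖Torus.convect (w₁ n) u x + Torus.convect u (w₁ n) x -
                (ν n) • Torus.laplacian u x + Torus.gradient r x -
                (c₁ n) • Torus.partialDeriv (2 : Fin 3) u x‖ ^ 2))) ∧
      ∀ K : ℕ, ∃ C : ℝ, ∀ n : ℕ,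
        ∃ (w : UnitAddTorus (Fin 3) → EuclideanSpace ℝ (Fin 3)) (q : UnitAddTorus (Fin 3) → ℝ) (c : ℝ),
          Torus.IsSmooth w ∧ Torus.IsSmooth q ∧ Torus.IsDivFree w ∧ Torus.HasZeroMean w ∧ |c| ≤ C ∧
          (∫ x, ‖w x‖ ^ 2) ≤ E ∧
          |ν n * Torus.gradNormSq w - ε₀| ≤ C * Real.sqrt (ν n) ∧
          (∫ x, ‖Torus.convect w w x - (ν n) • Torus.laplacian w x + Torus.gradient q x -
              c • Torus.partialDeriv (2 : Fin 3) w x - f x‖ ^ 2) ≤ C * (ν n) ^ K ∧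
          (∀ x, ‖w x‖ ≤ C) ∧ (∀ (i : Fin 3) x, ‖Torus.partialDeriv i w x‖ ≤ C * (ν n)⁻¹) ∧
          (∀ (i j : Fin 3) x, ‖Torus.partialDeriv i (Torus.partialDeriv j w) x‖ ≤ C * (ν n)⁻¹ ^ 2) ∧
          (∀ x, ‖w x - w₁ n x‖ ≤ C * (ν n) ^ a) ∧
          (∀ (i : Fin 3) x, ‖Torus.partialDeriv i w x - Torus.partialDeriv i (w₁ n) x‖ ≤ C * (ν n) ^ a) ∧
          |c - c₁ n| ≤ C * (ν n) ^ a) →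
    NonresonantTaylorWaves := fun h => nonresonantTaylorWaves_of_spineCore h

end Summit.AnomalousDissipation.AnomalousDissipation.Theorems

end
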